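import Summits.RiemannHypothesis.RiemannHypothesis.Theorems.GroundBartaEvenWinsBeyondArchDeflationPanelQLoc3
import Summits.RiemannHypothesis.RiemannHypothesis.Theorems.GroundBartaEvenWinsBeyondArchDeflationPanelQLoc1Four
import HarnessLib

/-!
# RiemannHypothesis / GroundBarta — rung 4 (`EvenWinsBeyondArch`, stmt-RiemannHypothesis-18807 / 18085):
# the deflated Temple L-side beyond `(log 5)/2`, XIX b′ part 3 (four slots) — chunked per-panel models with FOUR prime slots

Helper file (`--supports stmt-RiemannHypothesis-18807`), RH-free, no facts.  rh-explicit seat weil-5 (lead ruling R3-8a, 2026-08-22),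
four-slot twin of prover B's …DeflationPanelQLoc3: `dt_residualLocTM4'`, `dt_panelLTM4'`, `dt_panelLTM4'_eq` (rfl),
`dt_panelQL_bulk4'`, `dt_panelQL_split4'` on `dt_WinL4`.  Proofs = B's.

References: E. Bombieri, Rend. Mat. Acc. Lincei (9) 11 (2000) Thm 2 [Bombieri2000Weil]; Goerisch–Haunhorst (1985) [GoerischHaunhorst1985].
-/

set_option linter.dupNamespace false

noncomputable section

open MeasureTheory Set Filter intervalIntegral
open scoped Topology BigOperators

namespace Summit.RiemannHypothesis.RiemannHypothesis.Theorems.EvenWinsBeyondArch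

open Literature.NumberTheory.LFunctions
open Literature.Analysis.ValidatedNumerics Literature.Analysis.ValidatedNumerics.PolyMP
  Literature.Analysis.ValidatedNumerics.NumericsMP Literature.Analysis.ValidatedNumerics.ExpPoly

section PanelQ3F

variable {S : ℕ} {c : ℚ} {m Dl k : ℕ}

/-- `dt_residualLocTM` with the arch pieces supplied as literals. -/
def dt_residualLocTM4' (S : ℕ) (c : ℚ) (m k Dl K : ℕ) (gp pk : Poly) (Dρ : List (IPoly × Poly)) (PsiFar Pc Ps Eyp Eym : MI)
    (s1 s2 s3 s4 : MI × MI × Bool × Bool) (Etm Htm : IPoly) : IPoly :=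
  let h : ℚ := c / (2 * m)
  let y0 : ℚ := PolyMP.panelCentre h k
  let A0 := dt_locI S gp (ofRat S y0)
  let Gy := ttruncI S h Dl A0
  let pole := dt_poleTM S h K Pc Ps Eyp Eym
  let primes := taddI (taddI (taddI (dt_primeLocTM S h Dl gp y0 Gy s1) (dt_primeLocTM S h Dl gp y0 Gy s2))
    (dt_primeLocTM S h Dl gp y0 Gy s3)) (dt_primeLocTM S h Dl gp y0 Gy s4)
  let arch := taddI Etm Htm
  let psi := tmulI S h Dl Gy (taddI (treflI (weilArchTailTM S h Dρ (m - 1 - k) PsiFar)) (weilArchTailTM S h Dρ (m + k) PsiFar))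
  ttruncI S h Dl (taddI (taddI (taddI (taddI pole primes) arch) psi) (dt_locTM S h Dl pk (ofRat S y0)))

/-- The chunked per-panel model (bundles version). -/
def dt_panelLTM4' (S : ℕ) (c : ℚ) (m Dl K Ke ke : ℕ) (W : dt_WinL4 S c m Dl) (gp : Fin k → Poly) (Mt : ℚ)
    (Wt : Fin k → Fin k → ℚ) (i : Fin k) (V : dt_VecL S c m Dl (gp i)) (j : ℕ) (f1 f2 f3 f4 : Bool × Bool) (Etm Htm : IPoly) : IPoly :=
  dt_residualLocTM4' S c m j Dl K (gp i) (dt_killPoly gp Mt (Wt i) i) W.Dρ W.PsiFar V.Pc V.Ps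
    (expRatMI S Ke ke (PolyMP.panelCentre (c / (2 * m)) j / 2)) (expRatMI S Ke ke (-(PolyMP.panelCentre (c / (2 * m)) j / 2)))
    (W.Iw1, W.IL1, f1) (W.Iw2, W.IL2, f2) (W.Iw3, W.IL3, f3) (W.Iw4, W.IL4, f4) Etm Htm

/-- With the computed arch pieces the chunked model is the monolithic one (definitional). -/
theorem dt_panelLTM4'_eq (S : ℕ) (c : ℚ) (m Dl K Ke ke : ℕ) (W : dt_WinL4 S c m Dl) (gp : Fin k → Poly) (Mt : ℚ)
    (Wt : Fin k → Fin k → ℚ) (i : Fin k) (V : dt_VecL S c m Dl (gp i)) (j : ℕ) (f1 f2 f3 f4 : Bool × Bool) :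
    dt_panelLTM4' S c m Dl K Ke ke W gp Mt Wt i V j f1 f2 f3 f4 (dt_archETM S c m j Dl (dt_locI S (gp i) (ofRat S (PolyMP.panelCentre (c / (2 * m)) j))) W.M0 (ttruncI S (c / (2 * m)) Dl (dt_locI S (gp i) (ofRat S (PolyMP.panelCentre (c / (2 * m)) j)))) V.tabF W.muF (fun i ↦ (W.Dρ.getD i default).1) (fun i ↦ (W.Dρ.getD i default).2)) (dt_archHTM S c m j Dl (ttruncI S (c / (2 * m)) Dl (dt_locI S (gp i) (ofRat S (PolyMP.panelCentre (c / (2 * m)) j)))) V.tabF W.muF (fun i ↦ (W.Dρ.getD i default).1) (fun i ↦ (W.Dρ.getD i default).2)) =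
      dt_panelLTM4 S c m Dl K Ke ke W gp Mt Wt i V j f1 f2 f3 f4 := rfl

/-- **Bulk panel, chunked.** [cite: Bombieri2000Weil, Thm 2] [cite: GoerischHaunhorst1985, §2] -/
theorem dt_panelQL_bulk4' (hS : 0 < S) (hc : 0 < c) (W : dt_WinL4 S c m Dl) (hh1 : 2 * (c / (2 * m)) ≤ 1)
    (gp : Fin k → Poly) (Mt : ℚ) (Wt : Fin k → Fin k → ℚ) (i : Fin k) (V : dt_VecL S c m Dl (gp i)) {j : ℕ}
    (hjm : j + 2 ≤ m) {K : ℕ} (hK : 0 < K) {Ke ke : ℕ} {f1 f2 f3 f4 : Bool × Bool}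
    (hchk : dt_bulkCheckL4 S c m Dl W (gp i) j Ke ke f1 f2 f3 f4 = true)
    (hRi : IntervalIntegrable (fun ρ ↦
      dt_windowResidual4 (c : ℝ) gp W.w1 W.L1 W.w2 W.L2 W.w3 W.L3 W.w4 W.L4 (Mt : ℝ) (fun a l ↦ (Wt a l : ℝ)) i
        (((PolyMP.panelCentre (c / (2 * m)) j : ℚ) : ℝ) + ρ) ^ 2) volume (-((c / (2 * m) : ℚ) : ℝ)) ((c / (2 * m) : ℚ) : ℝ))
    {Etm Htm : IPoly} (hE : dt_archETM S c m j Dl (dt_locI S (gp i) (ofRat S (PolyMP.panelCentre (c / (2 * m)) j))) W.M0 (ttruncI S (c / (2 * m)) Dl (dt_locI S (gp i) (ofRat S (PolyMP.panelCentre (c / (2 * m)) j)))) V.tabF W.muF (fun i ↦ (W.Dρ.getD i default).1) (fun i ↦ (W.Dρ.getD i default).2) = Etm)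
    (hH : dt_archHTM S c m j Dl (ttruncI S (c / (2 * m)) Dl (dt_locI S (gp i) (ofRat S (PolyMP.panelCentre (c / (2 * m)) j)))) V.tabF W.muF (fun i ↦ (W.Dρ.getD i default).1) (fun i ↦ (W.Dρ.getD i default).2) = Htm) (p : Poly) :
    ∫ ρ in (-((c / (2 * m) : ℚ) : ℝ))..((c / (2 * m) : ℚ) : ℝ),
        dt_windowResidual4 (c : ℝ) gp W.w1 W.L1 W.w2 W.L2 W.w3 W.L3 W.w4 W.L4 (Mt : ℝ) (fun a l ↦ (Wt a l : ℝ)) i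
          (((PolyMP.panelCentre (c / (2 * m)) j : ℚ) : ℝ) + ρ) ^ 2 ≤
      ((sqIntegUpperQ S (c / (2 * m)) (dt_panelLTM4' S c m Dl K Ke ke W gp Mt Wt i V j f1 f2 f3 f4 Etm Htm) p : ℚ) : ℝ) := by
  subst hE; subst hH
  rw [dt_panelLTM4'_eq]
  exact dt_panelQL_bulk4 hS hc W hh1 gp Mt Wt i V hjm hK hchk hRi p

/-- **Split panel, chunked.** [cite: Bombieri2000Weil, Thm 2] [cite: GoerischHaunhorst1985, §2] -/
theorem dt_panelQL_split4' (hS : 0 < S) (hc : 0 < c) (W : dt_WinL4 S c m Dl) (hh1 : 2 * (c / (2 * m)) ≤ 1)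
    (gp : Fin k → Poly) (Mt : ℚ) (Wt : Fin k → Fin k → ℚ) (i : Fin k) (V : dt_VecL S c m Dl (gp i)) {j : ℕ}
    (hjm : j + 2 ≤ m) {K : ℕ} (hK : 0 < K) {Ke ke : ℕ} (f1 f2 f3 f4 f1' f2' f3' f4' : Bool × Bool) {β : ℝ} {bm bp : ℚ}
    (hchk : dt_splitCheckL S c m W.M0.length (gp i) j Ke ke bm bp = true) (hbmβ : (bm : ℝ) ≤ β) (hβbp : β ≤ bp)
    (hflA : ∀ ρ : ℝ, -((c / (2 * m) : ℚ) : ℝ) < ρ → ρ < β →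
      (f1.1 = true ↔ (((PolyMP.panelCentre (c / (2 * m)) j : ℚ) : ℝ) + ρ) - W.L1 ∈ Icc (-(c : ℝ)) c) ∧
      (f1.2 = true ↔ (((PolyMP.panelCentre (c / (2 * m)) j : ℚ) : ℝ) + ρ) + W.L1 ∈ Icc (-(c : ℝ)) c) ∧
      (f2.1 = true ↔ (((PolyMP.panelCentre (c / (2 * m)) j : ℚ) : ℝ) + ρ) - W.L2 ∈ Icc (-(c : ℝ)) c) ∧
      (f2.2 = true ↔ (((PolyMP.panelCentre (c / (2 * m)) j : ℚ) : ℝ) + ρ) + W.L2 ∈ Icc (-(c : ℝ)) c) ∧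
      (f3.1 = true ↔ (((PolyMP.panelCentre (c / (2 * m)) j : ℚ) : ℝ) + ρ) - W.L3 ∈ Icc (-(c : ℝ)) c) ∧
      (f3.2 = true ↔ (((PolyMP.panelCentre (c / (2 * m)) j : ℚ) : ℝ) + ρ) + W.L3 ∈ Icc (-(c : ℝ)) c) ∧
      (f4.1 = true ↔ (((PolyMP.panelCentre (c / (2 * m)) j : ℚ) : ℝ) + ρ) - W.L4 ∈ Icc (-(c : ℝ)) c) ∧
      (f4.2 = true ↔ (((PolyMP.panelCentre (c / (2 * m)) j : ℚ) : ℝ) + ρ) + W.L4 ∈ Icc (-(c : ℝ)) c))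
    (hflB : ∀ ρ : ℝ, β < ρ → ρ < ((c / (2 * m) : ℚ) : ℝ) →
      (f1'.1 = true ↔ (((PolyMP.panelCentre (c / (2 * m)) j : ℚ) : ℝ) + ρ) - W.L1 ∈ Icc (-(c : ℝ)) c) ∧
      (f1'.2 = true ↔ (((PolyMP.panelCentre (c / (2 * m)) j : ℚ) : ℝ) + ρ) + W.L1 ∈ Icc (-(c : ℝ)) c) ∧
      (f2'.1 = true ↔ (((PolyMP.panelCentre (c / (2 * m)) j : ℚ) : ℝ) + ρ) - W.L2 ∈ Icc (-(c : ℝ)) c) ∧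
      (f2'.2 = true ↔ (((PolyMP.panelCentre (c / (2 * m)) j : ℚ) : ℝ) + ρ) + W.L2 ∈ Icc (-(c : ℝ)) c) ∧
      (f3'.1 = true ↔ (((PolyMP.panelCentre (c / (2 * m)) j : ℚ) : ℝ) + ρ) - W.L3 ∈ Icc (-(c : ℝ)) c) ∧
      (f3'.2 = true ↔ (((PolyMP.panelCentre (c / (2 * m)) j : ℚ) : ℝ) + ρ) + W.L3 ∈ Icc (-(c : ℝ)) c) ∧
      (f4'.1 = true ↔ (((PolyMP.panelCentre (c / (2 * m)) j : ℚ) : ℝ) + ρ) - W.L4 ∈ Icc (-(c : ℝ)) c) ∧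
      (f4'.2 = true ↔ (((PolyMP.panelCentre (c / (2 * m)) j : ℚ) : ℝ) + ρ) + W.L4 ∈ Icc (-(c : ℝ)) c))
    (hRi : IntervalIntegrable (fun ρ ↦
      dt_windowResidual4 (c : ℝ) gp W.w1 W.L1 W.w2 W.L2 W.w3 W.L3 W.w4 W.L4 (Mt : ℝ) (fun a l ↦ (Wt a l : ℝ)) i
        (((PolyMP.panelCentre (c / (2 * m)) j : ℚ) : ℝ) + ρ) ^ 2) volume (-((c / (2 * m) : ℚ) : ℝ)) ((c / (2 * m) : ℚ) : ℝ))
    {Etm Htm : IPoly} (hE : dt_archETM S c m j Dl (dt_locI S (gp i) (ofRat S (PolyMP.panelCentre (c / (2 * m)) j))) W.M0 (ttruncI S (c / (2 * m)) Dl (dt_locI S (gp i) (ofRat S (PolyMP.panelCentre (c / (2 * m)) j)))) V.tabF W.muF (fun i ↦ (W.Dρ.getD i default).1) (fun i ↦ (W.Dρ.getD i default).2) = Etm)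
    (hH : dt_archHTM S c m j Dl (ttruncI S (c / (2 * m)) Dl (dt_locI S (gp i) (ofRat S (PolyMP.panelCentre (c / (2 * m)) j)))) V.tabF W.muF (fun i ↦ (W.Dρ.getD i default).1) (fun i ↦ (W.Dρ.getD i default).2) = Htm) (pA pB : Poly) :
    ∫ ρ in (-((c / (2 * m) : ℚ) : ℝ))..((c / (2 * m) : ℚ) : ℝ),
        dt_windowResidual4 (c : ℝ) gp W.w1 W.L1 W.w2 W.L2 W.w3 W.L3 W.w4 W.L4 (Mt : ℝ) (fun a l ↦ (Wt a l : ℝ)) i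
          (((PolyMP.panelCentre (c / (2 * m)) j : ℚ) : ℝ) + ρ) ^ 2 ≤
      ((sqIntegSubLocQ S (c / (2 * m)) (dt_panelLTM4' S c m Dl K Ke ke W gp Mt Wt i V j f1 f2 f3 f4 Etm Htm) pA
          (-(c / (2 * m))) bp : ℚ) : ℝ) +
        ((sqIntegSubLocQ S (c / (2 * m)) (dt_panelLTM4' S c m Dl K Ke ke W gp Mt Wt i V j f1' f2' f3' f4' Etm Htm) pB
          bm (c / (2 * m)) : ℚ) : ℝ) := by
  subst hE; subst hH
  rw [dt_panelLTM4'_eq, dt_panelLTM4'_eq]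
  exact dt_panelQL_split4 hS hc W hh1 gp Mt Wt i V hjm hK f1 f2 f3 f4 f1' f2' f3' f4' hchk hbmβ hβbp hflA hflB hRi pA pB

end PanelQ3F

end Summit.RiemannHypothesis.RiemannHypothesis.Theorems.EvenWinsBeyondArch

end
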